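import Summits.QuantumFields.YangMills.Theorems.BalabanLadderIRcofEquipartitionSeamSliceKernelSeam
import HarnessLib

/-!
# Crux `IRcof` (stmt-QuantumFields-26930) · line `equipartition_seam` (row 47) · located stub L `SpectralDict.SliceRealisationV` — helper:
# the gauge-averaged SLICE KERNEL of a GENERAL weight, F5 ∕ 7 — §11 the Z-PACKAGE `zPackage_of_twistSplitWeight`: every conjunct of the located stub L `SliceRealisationV` except (W), for the concrete slice data of a `TwistSplitWeight`

SOURCE OF RECORD: `Cruxes/IRcof/Lines/equipartition_seam_SliceKernel.lean` rev 9 (crux write 148dcb46cebb, 2172 l.; author ideator ym-ir-idea-22 g7; critic ym-ir-crit-3 g5 TYPEREADs CLEAN of revs 1–6 (bus l.1748 ∕ 1758 ∕ 1768 ∕ 1775 ∕ 1780), placement ruling H1 ∕ H2 (l.1748: §1 → Literature = lit-4 L34 p694639; §2 onward → ≤ 400-line Theorems files) — split VERBATIM along its §§ by LEAD prover ym-ir-line-ab-p1 g8 on the ideator's LAND-ASK H2 (bus l.1786 ∕ l.1789: files F1–F7, each importing the previous).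

HONEST FRAMING.  Elementary measure theory ∕ Fubini on compact groups (Lüscher 1977 ∕ Osterwalder–Seiler 1978 transfer-matrix positivity, weight-generic); proves NO located stub of row 47 by itself (S1, S3ʷ, T, L, N, S5ᵛ open); row 47 class PWP, mechanism 0, width 0; `IRcof` ∕ `IR` 0∕1; the Yang–Mills mass gap (Clay) is NOT proved by anything in this tree; R4 closes only the conditional finite-𝕋⁴ rung `BalabanLadder.UV`.
-/

noncomputable section

open MeasureTheory ProbabilityTheory Finset Filter Function
open scoped BigOperators

namespace Summit.QuantumFields.YangMills.Cruxes.IRcof.EquipartitionSeam.SliceKernel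

open Literature.Analysis.Matrix (IsPosDefKernel isPosDefKernel_const IsPosDefKernel.integral_prod_nonneg_of_measurable)
open Literature.MathematicalPhysics.QuantumFieldTheory (haarProbability integral_integral_fibreAverage_nonneg
  integrable_of_abs_le_one abs_mul_mul_le_one abs_integral_le_one)
open Literature.MathematicalPhysics.QuantumFieldTheory
open Summit.QuantumFields.YangMills.Cruxes.IRcof.EquipartitionSeam.KernelCurrency (sectorTensor withEl secZ secW)
open Literature.MathematicalPhysics.QuantumLattice (torusLift torusEdge)



/-! ## §11 The Z-PACKAGE: every conjunct of L except (W), for the concrete slice data -/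

section ZPackage

variable {b₁ b₂ b₃ : ℕ} {G H : Type} [Group G] [Group H] (π : H →* G)

/-- Auxiliary `elTwist_one` of the slice-kernel port (its statement is its type; rôle explained in the module ∕ section docstrings). -/
theorem elTwist_one : (elTwist π (1 : Fin 3 → ↥π.ker) : FinSpatialSite b₁ b₂ b₃ × Fin 3 → H) = 1 := by
  funext l
  simp only [elTwist, Pi.one_apply, OneMemClass.coe_one, ite_self]

/-- Auxiliary `elTwist_mul` of the slice-kernel port (its statement is its type; rôle explained in the module ∕ section docstrings). -/
theorem elTwist_mul (a b : Fin 3 → ↥π.ker) :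
    (elTwist π (a * b) : FinSpatialSite b₁ b₂ b₃ × Fin 3 → H) = elTwist π a * elTwist π b := by
  funext l
  simp only [elTwist, Pi.mul_apply, Subgroup.coe_mul]
  split_ifs <;> simp

/-- Central-valued link fields commute. -/
theorem elTwist_comm (hker : π.ker ≤ Subgroup.center H) (a b : Fin 3 → ↥π.ker) :
    (elTwist π a : FinSpatialSite b₁ b₂ b₃ × Fin 3 → H) * elTwist π b = elTwist π b * elTwist π a := by
  funext l
  simp only [Pi.mul_apply]
  exact Subgroup.mem_center_iff.mp (elTwist_mem_center π hker a l) _ |>.symm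

/-- The seam map `e ↦ elTwist π e⁻¹` is multiplicative (the electric twist group is commutative, `ker π` being central). -/
theorem elTwist_mul_inv (hker : π.ker ≤ Subgroup.center H) (a b : Fin 3 → ↥π.ker) :
    (elTwist π (a * b)⁻¹ : FinSpatialSite b₁ b₂ b₃ × Fin 3 → H) = elTwist π a⁻¹ * elTwist π b⁻¹ := by
  rw [mul_inv_rev, elTwist_mul, elTwist_comm π hker]

/-- Action laws of the seam operators `T e := ctwist (elTwist π e⁻¹)`. -/
theorem ctwist_elTwist_inv_one :
    ctwist (elTwist π (1 : Fin 3 → ↥π.ker)⁻¹ : FinSpatialSite b₁ b₂ b₃ × Fin 3 → H) = id := by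
  rw [inv_one, elTwist_one, ctwist_one]

/-- Auxiliary `ctwist_elTwist_inv_mul` of the slice-kernel port (its statement is its type; rôle explained in the module ∕ section docstrings). -/
theorem ctwist_elTwist_inv_mul (hker : π.ker ≤ Subgroup.center H) (a b : Fin 3 → ↥π.ker) :
    ctwist (elTwist π (a * b)⁻¹ : FinSpatialSite b₁ b₂ b₃ × Fin 3 → H) =
      ctwist (elTwist π a⁻¹) ∘ ctwist (elTwist π b⁻¹) := by
  rw [elTwist_mul_inv π hker, ctwist_mul]

variable [TopologicalSpace H] [IsTopologicalGroup H] [CompactSpace H] [MeasurableSpace H] [BorelSpace H]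
  [SecondCountableTopology H]

/-- **THE Z-PACKAGE.**  For the concrete slice data of the electric family of `z₀` — `X := FinSpatialSite (2S+1)³ × Fin 3 → H`,
`μ := ⊗Haar`, `K := sandKernel Prod.fst (l ↦ l.1 + e_{l.2}) w √(magW π w z₀ ·)`, `C := Ca·Cw^{|Λ|}·Ca`,
`T e := ctwist (elTwist π e⁻¹)` — ALL conjuncts of the located stub `SliceRealisationV` EXCEPT the species clause (W), in L's
literal order and shape: probability, `CountablyGenerated`, joint strong measurability, boundedness, symmetry, positive type (real
bounded measurable test functions), measure preservation, action laws, invariance of `K`, and the (Z) identity for every `e, M`.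
Hypotheses = clauses of `TwistSplitWeight` (continuity, `0 ≤ w`, a bound `Cw` — from compactness —, inversion and conjugation
invariance, positive definiteness of `(x, y) ↦ w(x⁻¹y)`) and `ker π ≤ centre`. [cite: Luscher1977] [cite: tHooft1979Flux]
[cite: OsterwalderSeiler1978] -/
theorem zPackage (w : H → ℝ) (hw : Continuous w) (hw0 : ∀ h, 0 ≤ w h) {Cw : ℝ} (hwC : ∀ h, w h ≤ Cw)
    (hinv : ∀ h, w h⁻¹ = w h) (hcl : ∀ g h : H, w (g * h * g⁻¹) = w h)
    (hpd : IsPosDefKernel fun x y : H => w (x⁻¹ * y)) (hker : π.ker ≤ Subgroup.center H) (z₀ : Sector π) (S : ℕ) :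
    IsProbabilityMeasure (Measure.pi fun _ : FinSpatialSite (2 * S + 1) (2 * S + 1) (2 * S + 1) × Fin 3 =>
      haarProbability H) ∧
    MeasurableSpace.CountablyGenerated (FinSpatialSite (2 * S + 1) (2 * S + 1) (2 * S + 1) × Fin 3 → H) ∧
    StronglyMeasurable (uncurry (sandKernel Prod.fst
      (fun l : FinSpatialSite (2 * S + 1) (2 * S + 1) (2 * S + 1) × Fin 3 => l.1.shift l.2) w
      (fun V => Real.sqrt (magW π w z₀ V)))) ∧
    (∀ x y, ‖sandKernel Prod.fst (fun l : FinSpatialSite (2 * S + 1) (2 * S + 1) (2 * S + 1) × Fin 3 => l.1.shift l.2) w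
        (fun V => Real.sqrt (magW π w z₀ V)) x y‖ ≤
      Real.sqrt ((Cw ^ Fintype.card SPlane) ^ Fintype.card (FinSpatialSite (2 * S + 1) (2 * S + 1) (2 * S + 1))) *
        Cw ^ Fintype.card (FinSpatialSite (2 * S + 1) (2 * S + 1) (2 * S + 1) × Fin 3) *
        Real.sqrt ((Cw ^ Fintype.card SPlane) ^ Fintype.card (FinSpatialSite (2 * S + 1) (2 * S + 1) (2 * S + 1)))) ∧
    (∀ x y, sandKernel Prod.fst (fun l : FinSpatialSite (2 * S + 1) (2 * S + 1) (2 * S + 1) × Fin 3 => l.1.shift l.2) w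
        (fun V => Real.sqrt (magW π w z₀ V)) x y =
      sandKernel Prod.fst (fun l : FinSpatialSite (2 * S + 1) (2 * S + 1) (2 * S + 1) × Fin 3 => l.1.shift l.2) w
        (fun V => Real.sqrt (magW π w z₀ V)) y x) ∧
    (∀ φ : (FinSpatialSite (2 * S + 1) (2 * S + 1) (2 * S + 1) × Fin 3 → H) → ℝ, Measurable φ → (∀ x, |φ x| ≤ 1) →
      0 ≤ ∫ x, ∫ y, φ x * sandKernel Prod.fst
          (fun l : FinSpatialSite (2 * S + 1) (2 * S + 1) (2 * S + 1) × Fin 3 => l.1.shift l.2) w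
          (fun V => Real.sqrt (magW π w z₀ V)) x y * φ y
        ∂(Measure.pi fun _ : FinSpatialSite (2 * S + 1) (2 * S + 1) (2 * S + 1) × Fin 3 => haarProbability H)
        ∂(Measure.pi fun _ : FinSpatialSite (2 * S + 1) (2 * S + 1) (2 * S + 1) × Fin 3 => haarProbability H)) ∧
    (∀ e : Fin 3 → ↥π.ker, MeasurePreserving
      (ctwist (elTwist π e⁻¹) : (FinSpatialSite (2 * S + 1) (2 * S + 1) (2 * S + 1) × Fin 3 → H) → _)
      (Measure.pi fun _ : FinSpatialSite (2 * S + 1) (2 * S + 1) (2 * S + 1) × Fin 3 => haarProbability H)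
      (Measure.pi fun _ : FinSpatialSite (2 * S + 1) (2 * S + 1) (2 * S + 1) × Fin 3 => haarProbability H)) ∧
    ctwist (elTwist π (1 : Fin 3 → ↥π.ker)⁻¹ : FinSpatialSite (2 * S + 1) (2 * S + 1) (2 * S + 1) × Fin 3 → H) = id ∧
    (∀ a b : Fin 3 → ↥π.ker,
      ctwist (elTwist π (a * b)⁻¹ : FinSpatialSite (2 * S + 1) (2 * S + 1) (2 * S + 1) × Fin 3 → H) =
        ctwist (elTwist π a⁻¹) ∘ ctwist (elTwist π b⁻¹)) ∧
    (∀ (e : Fin 3 → ↥π.ker) (x y : FinSpatialSite (2 * S + 1) (2 * S + 1) (2 * S + 1) × Fin 3 → H),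
      sandKernel Prod.fst (fun l : FinSpatialSite (2 * S + 1) (2 * S + 1) (2 * S + 1) × Fin 3 => l.1.shift l.2) w
          (fun V => Real.sqrt (magW π w z₀ V)) (ctwist (elTwist π e⁻¹) x) (ctwist (elTwist π e⁻¹) y) =
        sandKernel Prod.fst (fun l : FinSpatialSite (2 * S + 1) (2 * S + 1) (2 * S + 1) × Fin 3 => l.1.shift l.2) w
          (fun V => Real.sqrt (magW π w z₀ V)) x y) ∧
    (∀ (e : Fin 3 → ↥π.ker) (M : ℕ),
      secZ π w (withEl π z₀ e) S (M + 2) =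
        ∫ x, ((fun f : (FinSpatialSite (2 * S + 1) (2 * S + 1) (2 * S + 1) × Fin 3 → H) → ℝ => fun u =>
            ∫ y, sandKernel Prod.fst (fun l : FinSpatialSite (2 * S + 1) (2 * S + 1) (2 * S + 1) × Fin 3 => l.1.shift l.2) w
                (fun V => Real.sqrt (magW π w z₀ V)) u y * f y
              ∂(Measure.pi fun _ : FinSpatialSite (2 * S + 1) (2 * S + 1) (2 * S + 1) × Fin 3 => haarProbability H))^[M + 1]
            (fun y => sandKernel Prod.fst
              (fun l : FinSpatialSite (2 * S + 1) (2 * S + 1) (2 * S + 1) × Fin 3 => l.1.shift l.2) w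
              (fun V => Real.sqrt (magW π w z₀ V)) y x)) (ctwist (elTwist π e⁻¹) x)
          ∂(Measure.pi fun _ : FinSpatialSite (2 * S + 1) (2 * S + 1) (2 * S + 1) × Fin 3 => haarProbability H)) := by
  refine ⟨inferInstance, countablyGenerated_slice,
    stronglyMeasurable_uncurry_sandKernel _ _ w _ hw (measurable_sqrt_magW π w hw z₀),
    norm_sandKernel_le _ _ w _ hw0 hwC (abs_sqrt_magW_le π w hw0 hwC z₀),
    sandKernel_symm _ _ w _ hw hinv hcl,
    posType_sandKernel _ _ w _ hw hw0 hwC hcl hpd (measurable_sqrt_magW π w hw z₀) (abs_sqrt_magW_le π w hw0 hwC z₀),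
    fun e => measurePreserving_ctwist _, ctwist_elTwist_inv_one π, ctwist_elTwist_inv_mul π hker,
    fun e => sandKernel_ctwist _ _ w _ (elTwist_mem_center π hker e⁻¹) (sqrt_magW_ctwist_elTwist π w hker z₀ e⁻¹),
    fun e M => secZ_withEl_eq_integral_iterate π w hw hw0 hwC hcl hker z₀ e S M⟩


/-- **The Z-package from `TwistSplitWeight` directly**: clauses 1–5 of the splitting weight (continuity, `0 ≤ w`, inversion and
conjugation invariance, complex positive type) and compactness of `H` (a bound `Cw`) feed `zPackage`; clauses 6–7 (the `ker π`-sum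
rule and the label-noise bound) are not needed for the (Z) side. -/
theorem zPackage_of_twistSplitWeight [TopologicalSpace G] {ρH : LatticeRep H} {r : LatticeRep G} {c β : ℝ} {w : H → ℝ}
    (hT : Summit.QuantumFields.YangMills.Theorems.NonSimplyConnectedLatticeGap.TwistSplitWeight π ρH r c β w)
    (hker : π.ker ≤ Subgroup.center H) (z₀ : Sector π) (S : ℕ) :
    ∃ C : ℝ,
      IsProbabilityMeasure (Measure.pi fun _ : FinSpatialSite (2 * S + 1) (2 * S + 1) (2 * S + 1) × Fin 3 =>
        haarProbability H) ∧
      MeasurableSpace.CountablyGenerated (FinSpatialSite (2 * S + 1) (2 * S + 1) (2 * S + 1) × Fin 3 → H) ∧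
      StronglyMeasurable (uncurry (sandKernel Prod.fst
        (fun l : FinSpatialSite (2 * S + 1) (2 * S + 1) (2 * S + 1) × Fin 3 => l.1.shift l.2) w
        (fun V => Real.sqrt (magW π w z₀ V)))) ∧
      (∀ x y, ‖sandKernel Prod.fst (fun l : FinSpatialSite (2 * S + 1) (2 * S + 1) (2 * S + 1) × Fin 3 => l.1.shift l.2) w
          (fun V => Real.sqrt (magW π w z₀ V)) x y‖ ≤
        C) ∧
      (∀ x y, sandKernel Prod.fst (fun l : FinSpatialSite (2 * S + 1) (2 * S + 1) (2 * S + 1) × Fin 3 => l.1.shift l.2) w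
          (fun V => Real.sqrt (magW π w z₀ V)) x y =
        sandKernel Prod.fst (fun l : FinSpatialSite (2 * S + 1) (2 * S + 1) (2 * S + 1) × Fin 3 => l.1.shift l.2) w
          (fun V => Real.sqrt (magW π w z₀ V)) y x) ∧
      (∀ φ : (FinSpatialSite (2 * S + 1) (2 * S + 1) (2 * S + 1) × Fin 3 → H) → ℝ, Measurable φ → (∀ x, |φ x| ≤ 1) →
        0 ≤ ∫ x, ∫ y, φ x * sandKernel Prod.fst
            (fun l : FinSpatialSite (2 * S + 1) (2 * S + 1) (2 * S + 1) × Fin 3 => l.1.shift l.2) w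
            (fun V => Real.sqrt (magW π w z₀ V)) x y * φ y
          ∂(Measure.pi fun _ : FinSpatialSite (2 * S + 1) (2 * S + 1) (2 * S + 1) × Fin 3 => haarProbability H)
          ∂(Measure.pi fun _ : FinSpatialSite (2 * S + 1) (2 * S + 1) (2 * S + 1) × Fin 3 => haarProbability H)) ∧
      (∀ e : Fin 3 → ↥π.ker, MeasurePreserving
        (ctwist (elTwist π e⁻¹) : (FinSpatialSite (2 * S + 1) (2 * S + 1) (2 * S + 1) × Fin 3 → H) → _)
        (Measure.pi fun _ : FinSpatialSite (2 * S + 1) (2 * S + 1) (2 * S + 1) × Fin 3 => haarProbability H)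
        (Measure.pi fun _ : FinSpatialSite (2 * S + 1) (2 * S + 1) (2 * S + 1) × Fin 3 => haarProbability H)) ∧
      ctwist (elTwist π (1 : Fin 3 → ↥π.ker)⁻¹ : FinSpatialSite (2 * S + 1) (2 * S + 1) (2 * S + 1) × Fin 3 → H) = id ∧
      (∀ a b : Fin 3 → ↥π.ker,
        ctwist (elTwist π (a * b)⁻¹ : FinSpatialSite (2 * S + 1) (2 * S + 1) (2 * S + 1) × Fin 3 → H) =
          ctwist (elTwist π a⁻¹) ∘ ctwist (elTwist π b⁻¹)) ∧
      (∀ (e : Fin 3 → ↥π.ker) (x y : FinSpatialSite (2 * S + 1) (2 * S + 1) (2 * S + 1) × Fin 3 → H),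
        sandKernel Prod.fst (fun l : FinSpatialSite (2 * S + 1) (2 * S + 1) (2 * S + 1) × Fin 3 => l.1.shift l.2) w
            (fun V => Real.sqrt (magW π w z₀ V)) (ctwist (elTwist π e⁻¹) x) (ctwist (elTwist π e⁻¹) y) =
          sandKernel Prod.fst (fun l : FinSpatialSite (2 * S + 1) (2 * S + 1) (2 * S + 1) × Fin 3 => l.1.shift l.2) w
            (fun V => Real.sqrt (magW π w z₀ V)) x y) ∧
      (∀ (e : Fin 3 → ↥π.ker) (M : ℕ),
        secZ π w (withEl π z₀ e) S (M + 2) =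
          ∫ x, ((fun f : (FinSpatialSite (2 * S + 1) (2 * S + 1) (2 * S + 1) × Fin 3 → H) → ℝ => fun u =>
              ∫ y, sandKernel Prod.fst (fun l : FinSpatialSite (2 * S + 1) (2 * S + 1) (2 * S + 1) × Fin 3 => l.1.shift l.2) w
                  (fun V => Real.sqrt (magW π w z₀ V)) u y * f y
                ∂(Measure.pi fun _ : FinSpatialSite (2 * S + 1) (2 * S + 1) (2 * S + 1) × Fin 3 => haarProbability H))^[M + 1]
              (fun y => sandKernel Prod.fst
                (fun l : FinSpatialSite (2 * S + 1) (2 * S + 1) (2 * S + 1) × Fin 3 => l.1.shift l.2) w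
                (fun V => Real.sqrt (magW π w z₀ V)) y x)) (ctwist (elTwist π e⁻¹) x)
            ∂(Measure.pi fun _ : FinSpatialSite (2 * S + 1) (2 * S + 1) (2 * S + 1) × Fin 3 => haarProbability H))  := by
  obtain ⟨hw, hw0, hinv, hcl, h5, -, -⟩ := hT
  obtain ⟨h₀, -, hmax⟩ := isCompact_univ.exists_isMaxOn Set.univ_nonempty hw.continuousOn
  have hwC : ∀ h, w h ≤ w h₀ := fun h => hmax (Set.mem_univ h)
  exact ⟨_, zPackage π w hw hw0 hwC hinv hcl (isPosDefKernel_of_re_sum w hinv h5) hker z₀ S⟩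

end ZPackage

end Summit.QuantumFields.YangMills.Cruxes.IRcof.EquipartitionSeam.SliceKernel

end
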